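import Mathlib

/-!
# Chain resolvent: the closed form of a chain of rank-one factors (`stub_chainResolvent`)

For `m` rank-one `3 × 3` matrices `N_t = u_t w_tᵀ` and variables `x_{v_t}` the chain
`Π_{t<m} (1 + x_{v_t} N_t)` equals `1 + Uᵀ D (Σ_{d<m} (G D)^d) W`, where `U = (u_t(i))_{t,i}`,
`W = (w_t(j))_{t,j}`, `D = diag (x_{v_t})` and `G_{st} = [s < t] · (w_s ⬝ᵥ u_t)` is the
strictly upper triangular transfer matrix (everything pushed into `MvPolynomial σ ℂ` by `C`).

Proof: with `m` fixed, induction on the length `k` of a prefix of the chain, with the invariant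
`Π_{t<k} (1 + x_{v_t} N_t) = 1 + Uᵀ D S Π_k W`, `S = Σ_{d<m} (G D)^d`, `Π_k = diag [t < k]`.
The step uses `x_k N_k = Uᵀ D E_{kk} W`, `Π_k W Uᵀ D E_{kk} = G D E_{kk}` (column `k` of `G`)
and `S E_{kk} = E_{kk} + S (G D) E_{kk}`, which follows from `S = 1 + S (G D)`, i.e. from the
nilpotency `(G D)^m = 0` of the strictly upper triangular matrix `G D`.
-/

set_option linter.dupNamespace false

namespace Summit.ValiantsHypothesis.ValiantsHypothesis.Theorems.WordPerSuperQuartic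

open Matrix

variable {R : Type*} [CommRing R]

/-- Entries of powers of a strictly upper triangular matrix: `(M ^ d) s t = 0` unless
`s + d ≤ t`. -/
private theorem chainResolvent_pow_apply {m : ℕ} (M : Matrix (Fin m) (Fin m) R)
    (hM : ∀ s t : Fin m, (t : ℕ) ≤ s → M s t = 0) :
    ∀ (d : ℕ) (s t : Fin m), (t : ℕ) < s + d → (M ^ d) s t = 0 := by
  intro d
  induction d with
  | zero =>
    intro s t hst
    rw [pow_zero, Matrix.one_apply_ne]
    intro h
    subst h
    omega
  | succ d ih =>
    intro s t hst
    rw [pow_succ, Matrix.mul_apply]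
    refine Finset.sum_eq_zero (fun r _ => ?_)
    by_cases hrt : (t : ℕ) ≤ r
    · rw [hM r t hrt, mul_zero]
    · rw [ih s r (by omega), zero_mul]

/-- A strictly upper triangular `m × m` matrix `M` satisfies `M ^ m = 0`. -/
private theorem chainResolvent_pow_eq_zero {m : ℕ} (M : Matrix (Fin m) (Fin m) R)
    (hM : ∀ s t : Fin m, (t : ℕ) ≤ s → M s t = 0) : M ^ m = 0 := by
  ext s t
  exact chainResolvent_pow_apply M hM m s t (by have := t.is_lt; omega)

/-- The truncated geometric series `S = Σ_{d<m} M^d` of a strictly upper triangular `m × m`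
matrix satisfies `S = 1 + S M`. -/
private theorem chainResolvent_geom {m : ℕ} (M : Matrix (Fin m) (Fin m) R)
    (hM : ∀ s t : Fin m, (t : ℕ) ≤ s → M s t = 0) :
    (∑ d ∈ Finset.range m, M ^ d) = 1 + (∑ d ∈ Finset.range m, M ^ d) * M := by
  have h : ∑ d ∈ Finset.range (m + 1), M ^ d = ∑ d ∈ Finset.range m, M ^ (d + 1) + M ^ 0 :=
    Finset.sum_range_succ' (fun d => M ^ d) m
  rw [Finset.sum_range_succ, chainResolvent_pow_eq_zero M hM, add_zero, pow_zero] at h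
  conv_lhs => rw [h]
  rw [add_comm, Finset.sum_mul]
  simp_rw [pow_succ]

/-- One factor of the chain as a sandwich: `x_k • u_k w_kᵀ = Uᵀ D E_{kk} W`. -/
private theorem chainResolvent_factor {m : ℕ} {p q : Type*} (u : Fin m → p → R)
    (w : Fin m → q → R) (x : Fin m → R) (k : Fin m) :
    x k • Matrix.vecMulVec (u k) (w k) =
      (Matrix.of (fun t i => u t i))ᵀ * Matrix.diagonal x * Matrix.single k k (1 : R) *
        Matrix.of (fun t j => w t j) := by
  ext i j
  rw [Matrix.mul_apply, Finset.sum_eq_single k]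
  · simp [Matrix.vecMulVec_apply]
    ring
  · intro t _ htk
    simp [htk]
  · simp

/-- `X E_{kk}` only depends on column `k` of `X`. -/
private theorem chainResolvent_mul_single {m : ℕ} {p : Type*} (X Y : Matrix p (Fin m) R)
    (k : Fin m) (h : ∀ s, X s k = Y s k) :
    X * Matrix.single k k (1 : R) = Y * Matrix.single k k (1 : R) := by
  ext s t
  by_cases ht : t = k
  · subst ht
    simp [h]
  · simp [ht]

/-- The transfer identity `Π_k W Uᵀ D E_{kk} = G D E_{kk}`: column `k` of `Π_k W Uᵀ` is column
`k` of `G`. -/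
private theorem chainResolvent_transfer {m : ℕ} {n : Type*} [Fintype n] (x : Fin m → R)
    (u w : Fin m → n → R) (c : Fin m → Fin m → R) (hc : ∀ s t, c s t = w s ⬝ᵥ u t)
    (k : ℕ) (hk : k < m) :
    Matrix.diagonal (fun t : Fin m => if (t : ℕ) < k then (1 : R) else 0) *
          Matrix.of (fun t j => w t j) *
        ((Matrix.of (fun t i => u t i))ᵀ * Matrix.diagonal x) *
        Matrix.single (⟨k, hk⟩ : Fin m) (⟨k, hk⟩ : Fin m) (1 : R) =
      Matrix.of (fun s t : Fin m => if s < t then c s t else 0) * Matrix.diagonal x *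
        Matrix.single (⟨k, hk⟩ : Fin m) (⟨k, hk⟩ : Fin m) (1 : R) := by
  apply chainResolvent_mul_single
  intro s
  rw [Matrix.mul_assoc, Matrix.diagonal_mul, Matrix.mul_diagonal, Matrix.of_apply, hc,
    ← Matrix.mul_assoc, Matrix.mul_diagonal]
  have hWU : (Matrix.of (fun t j => w t j) * (Matrix.of (fun t i => u t i))ᵀ) s ⟨k, hk⟩ =
      w s ⬝ᵥ u ⟨k, hk⟩ := by
    simp [Matrix.mul_apply, dotProduct]
  rw [hWU]
  have hlt : (s < (⟨k, hk⟩ : Fin m)) ↔ (s : ℕ) < k := Fin.lt_def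
  by_cases hs : (s : ℕ) < k
  · rw [if_pos hs, if_pos (hlt.2 hs), one_mul]
  · rw [if_neg hs, if_neg (fun h => hs (hlt.1 h)), zero_mul, zero_mul]

/-- The prefix projections: `Π_{k+1} = Π_k + E_{kk}`. -/
private theorem chainResolvent_proj_succ {m : ℕ} (k : ℕ) (hk : k < m) :
    Matrix.diagonal (fun t : Fin m => if (t : ℕ) < k + 1 then (1 : R) else 0) =
      Matrix.diagonal (fun t : Fin m => if (t : ℕ) < k then (1 : R) else 0) +
        Matrix.single (⟨k, hk⟩ : Fin m) (⟨k, hk⟩ : Fin m) (1 : R) := by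
  rw [← Matrix.diagonal_single, Matrix.diagonal_add]
  congr 1
  funext t
  by_cases ht : t = ⟨k, hk⟩
  · subst ht
    simp
  · rw [Pi.single_eq_of_ne ht]
    have hne : (t : ℕ) ≠ k := fun h => ht (Fin.ext h)
    have hiff : (t : ℕ) < k + 1 ↔ (t : ℕ) < k := by omega
    simp [hiff]

/-- The full projection is the identity: `Π_m = 1`. -/
private theorem chainResolvent_proj_self {m : ℕ} :
    Matrix.diagonal (fun t : Fin m => if (t : ℕ) < m then (1 : R) else 0) = 1 := by
  rw [← Matrix.diagonal_one]
  congr 1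
  funext t
  simp [t.is_lt]

/-- The algebra of the induction step: if `S = 1 + S M` and `P W A E = M E` then
`(1 + A S P W)(1 + A E W) = 1 + A S (P + E) W`. -/
private theorem chainResolvent_step {a b : Type*} [Fintype a] [DecidableEq a] [Fintype b]
    [DecidableEq b] (A : Matrix b a R) (W : Matrix a b R) (S M P E : Matrix a a R)
    (h3 : S = 1 + S * M) (h5 : P * W * A * E = M * E) :
    (1 + A * S * P * W) * (1 + A * E * W) = 1 + A * S * (P + E) * W := by
  have hSE : S * E = E + S * (P * W * A * E) := by
    rw [h5, ← Matrix.mul_assoc S M E]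
    conv_lhs => rw [h3]
    rw [Matrix.add_mul, Matrix.one_mul]
  rw [Matrix.mul_add (A * S) P E, Matrix.mul_assoc A S E, hSE]
  simp only [Matrix.mul_add, Matrix.add_mul, Matrix.one_mul, Matrix.mul_one, Matrix.mul_assoc]
  abel

/-- The chain resolvent over an arbitrary commutative ring (generic entries). -/
private theorem chainResolvent_aux {n : Type*} [Fintype n] [DecidableEq n] (m : ℕ)
    (x : Fin m → R) (u w : Fin m → n → R) (c : Fin m → Fin m → R)
    (hc : ∀ s t, c s t = w s ⬝ᵥ u t) :
    (List.ofFn (fun t : Fin m => (1 : Matrix n n R) + x t • Matrix.vecMulVec (u t) (w t))).prod =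
      1 + (Matrix.of (fun t i => u t i))ᵀ * Matrix.diagonal x *
        (∑ d ∈ Finset.range m,
          (Matrix.of (fun s t : Fin m => if s < t then c s t else 0) * Matrix.diagonal x) ^ d) *
        Matrix.of (fun t j => w t j) := by
  have hGD : ∀ s t : Fin m, (t : ℕ) ≤ s →
      (Matrix.of (fun s t : Fin m => if s < t then c s t else 0) * Matrix.diagonal x) s t = 0 := by
    intro s t hts
    rw [Matrix.mul_diagonal, Matrix.of_apply, if_neg (by rw [Fin.lt_def]; omega), zero_mul]
  suffices key : ∀ k : ℕ, k ≤ m →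
      ((List.ofFn (fun t : Fin m =>
          (1 : Matrix n n R) + x t • Matrix.vecMulVec (u t) (w t))).take k).prod =
        1 + (Matrix.of (fun t i => u t i))ᵀ * Matrix.diagonal x *
          (∑ d ∈ Finset.range m,
            (Matrix.of (fun s t : Fin m => if s < t then c s t else 0) * Matrix.diagonal x) ^ d) *
          Matrix.diagonal (fun t : Fin m => if (t : ℕ) < k then (1 : R) else 0) *
          Matrix.of (fun t j => w t j) by
    have h := key m le_rfl
    rwa [List.take_of_length_le (by simp), chainResolvent_proj_self, Matrix.mul_one] at h
  intro k
  induction k with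
  | zero =>
    intro
    simp
  | succ k ih =>
    intro hk
    have hkm : k < m := hk
    rw [List.prod_take_succ _ _ (by simpa using hkm), ih hkm.le, List.getElem_ofFn]
    rw [chainResolvent_factor u w x ⟨k, hkm⟩, chainResolvent_proj_succ k hkm]
    exact chainResolvent_step _ _ _ _ _ _ (chainResolvent_geom _ hGD)
      (chainResolvent_transfer x u w c hc k hkm)

/-- R5 — **chain resolvent (closed form)**: a chain of rank-one matrices `u_t w_tᵀ` equals
`1 + Uᵀ·D·(Σ_{d<m} (G·D)^d)·W` with `D = diag(x_{v_t})` and the strictly upper triangular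
transfer matrix `G_{st} = [s < t]·(w_s ⬝ᵥ u_t)`; it holds over any commutative ring and does
not need `w_t ⬝ᵥ u_t = 0` (see `chainResolvent_aux`). -/
theorem stub_chainResolvent {σ : Type} [DecidableEq σ] (m : ℕ) (v : Fin m → σ)
    (u w : Fin m → Fin 3 → ℂ) :
    ((List.ofFn (fun t : Fin m => (v t, Matrix.vecMulVec (u t) (w t)))).map
        (fun e => (1 : Matrix (Fin 3) (Fin 3) (MvPolynomial σ ℂ)) +
          (MvPolynomial.X e.1 : MvPolynomial σ ℂ) •
            e.2.map (MvPolynomial.C : ℂ → MvPolynomial σ ℂ))).prod =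
      1 + Matrix.transpose
              (Matrix.of (fun t i => MvPolynomial.C (u t i)) :
                Matrix (Fin m) (Fin 3) (MvPolynomial σ ℂ)) *
            Matrix.diagonal (fun t => (MvPolynomial.X (v t) : MvPolynomial σ ℂ)) *
            (∑ d ∈ Finset.range m,
              ((Matrix.of (fun s t : Fin m =>
                  if s < t then MvPolynomial.C (w s ⬝ᵥ u t) else 0) :
                    Matrix (Fin m) (Fin m) (MvPolynomial σ ℂ)) *
                Matrix.diagonal (fun t => (MvPolynomial.X (v t) : MvPolynomial σ ℂ))) ^ d) *
            (Matrix.of (fun t j => MvPolynomial.C (w t j)) :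
              Matrix (Fin m) (Fin 3) (MvPolynomial σ ℂ)) := by
  rw [List.map_ofFn]
  convert chainResolvent_aux (R := MvPolynomial σ ℂ) m
    (fun t => (MvPolynomial.X (v t) : MvPolynomial σ ℂ)) (fun t i => MvPolynomial.C (u t i))
    (fun t j => MvPolynomial.C (w t j)) (fun s t => MvPolynomial.C (w s ⬝ᵥ u t))
    (fun s t => RingHom.map_dotProduct MvPolynomial.C (w s) (u t)) using 3
  funext t
  simp only [Function.comp_apply]
  congr 1
  ext i j
  simp [Matrix.vecMulVec_apply]

end Summit.ValiantsHypothesis.ValiantsHypothesis.Theorems.WordPerSuperQuartic
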